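import Summits.BirchSwinnertonDyer.BirchSwinnertonDyer.Theses.KatoDescentPotSupersingular
import Summits.BirchSwinnertonDyer.BirchSwinnertonDyer.Theorems.KatoDescentPotSupersingularWildCoatesSujathaResidueOfKatoZetaLine
import HarnessLib

/-!
# Route `KatoDescentPotSupersingular` (rung K9, cell `bsd-potss`): CLOSER of the generated split glue
# `WildCoatesSujathaResidueOfKatoZeta : HeldKatoZetaBodyInputs → WildKatoZetaIndivisible → WildCoatesSujathaResidue`
# (plan g25 split of item 19942, kit k9-c4 g15) — one term over the landed helper p591994

Seat `bsd-potss-k9-c4` g15.  File it `--workitem <glue item id>` once the planner's `--split WildCoatesSujathaResidue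
--into children_K9.json --glue-decl-name WildCoatesSujathaResidueOfKatoZeta` has landed.  The two child defs unfold
by `rfl` to the hypotheses of `Theorems.wildCoatesSujathaResidue_of_katoZetaBodyInputs_of_katoZetaLine` (statements
typed verbatim from the same source).  HONEST FRAMING: closes a GLUE item only; 19942's open content becomes the crux
child `WildKatoZetaIndivisible`; BSD is not advanced; nothing is booked.
-/

-- the summit and its single problem are both named `BirchSwinnertonDyer` (registry layout D-0017)
set_option linter.dupNamespace false
set_option autoImplicit false

namespace Summit.BirchSwinnertonDyer.BirchSwinnertonDyer.Theorems

/-- **The split glue `WildCoatesSujathaResidueOfKatoZeta` holds** (children ⟹ parent), by the landed conditional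
closer-helper `wildCoatesSujathaResidue_of_katoZetaBodyInputs_of_katoZetaLine` (k9-c4 g15, p591994).
[cite: Kato2004Asterisque, Ex. 13.3 (p. 225), Thm. 12.5 (1) (pp. 221–222), Thm. 13.4 (p. 226)] [cite: CoatesSujatha2005, Conjecture A] -/
theorem wildCoatesSujathaResidueOfKatoZeta_proof :
    Summit.BirchSwinnertonDyer.BirchSwinnertonDyer.Theses.KatoDescentPotSupersingular.WildCoatesSujathaResidueOfKatoZeta :=
  fun h1 h2 => wildCoatesSujathaResidue_of_katoZetaBodyInputs_of_katoZetaLine h1 h2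

end Summit.BirchSwinnertonDyer.BirchSwinnertonDyer.Theorems
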